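import Summits.NavierStokesRegularity.FluidComputer.GateBudgetPulseStep
import HarnessLib

/-!
# What no tuning can beat, part 53: THE CLOCK-PAIR RADIUS IS LIPSCHITZ — `|∂ₜ√(b² + c²)| ≤ ε + σ`
# along ANY trajectory of the five-gate circuit, at ANY time; hence a pulse of length `≤ 242/K⁹`
# entered with radius `≤ 2ε` keeps `b² + c²` to `ε²/10⁶` WITHOUT part 45's horizon cap `T ≤ 5`

Cell `pub-fluidc`, blueprint seat bp1 (gen 34, fourth item); same namespace and conventions as
parts 1–52 (`GateBudget*.lean`); imports part 52 (`GateBudgetPulseStep`) and through it part 1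
(`bc_energy`: `∂ₜ(b² + c²) = 2εa²b + 2σa²c`, `traj_sq_le_one`, `c_nonneg`) and the Literature
toolkit `Thm53.antitoneOn_sub_of_deriv_le`. Modes `0 = a`, `1 = b` clock, `2 = c` trigger of
`fiveGateCircuit ε σ μ R K` (§157: any couplings with `ε, σ ≥ 0`) resp. of `rotorCircuit K M ε
ρ` from (5.6) (§158: `σ = ρ²e^{-M}`). HONEST FRAMING (verbatim): low prior, high
value-of-information experiment on Tao's machine paradigm; NOT a claim that NS blows up.
Nothing is proved about the Navier–Stokes equations.

THE POINT (SPEC-INPUT-bp1 §AW successor (20′b) HORIZON-FREE RE-TYPING, first of its five laws).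
Part 45 §135 `knob_pulse_radius_kept` keeps the clock-pair radius through a pulse `[s, T]`,
`T - s ≤ 242/K⁹`, only for `T ≤ 5`: its §134 bounds the pumps `2εa²b + 2σa²c` through the
crude growth `|b|, c ≤ (ε + σ)t` from time `0`, so the budget is `(ε + σ)²(T² - s²)` and needs
a horizon. The ladder's `n`-th pulse sits at `t ≈ 2.85n`, up to `n ≍ K⁸`. The cap is not in
the dynamics: `∂ₜ(b² + c²) = 2a²(εb + σc)` and `|εb + σc| ≤ (ε + σ)√(b² + c²)` (`a² ≤ 1`, `c ≥
0`), so `√(b² + c²)` is `(ε + σ)`-LIPSCHITZ at every time — the clock-pair analogue of part 51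
§150's dose law for `√(d² + ã²)`, proved the same way (the `η`-regularised root `√(b² + c² +
η²)`, the toolkit's monotonicity lemma, `η → 0⁺`).
* §157 `radius_sqrt_lipschitz`: five-gate circuit, `ε, σ ≥ 0`, trajectory from (5.6), `0 ≤ T`:
  for `t ∈ [T, T']`, `√(b² + c²)(t) ≤ √(b² + c²)(T) + (ε + σ)(t - T)` and `√(b² + c²)(T) ≤ √(b²
  + c²)(t) + (ε + σ)(t - T)`.
* §158 `knob_radius_kept_free`: knob family `rotorCircuit K M ε ρ` with `M ≥ 0`, `0 < ε`, `ρ² ≤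
  ε`, `K ≥ 16`; ANY `0 ≤ s ≤ T` with `T - s ≤ 242/K⁹` and entry radius `b(s)² + c(s)² ≤ 4ε²`:
  `|b(t)² + c(t)² - (b(s)² + c(s)²)| ≤ ε²/10⁶` for every `t ∈ [s, T]` — §135's conclusion (on
  the whole pulse, as part 45's `hkept` and part 52 §153 consume it) with `T ≤ 5` replaced by
  the LOCAL hypothesis on the entry radius, which every rung of the ladder supplies (`b(r_n) ≤
  1.44ε`, `c(r_n) = ρ²/K⁹`). (`σ = ρ²e^{-M} ≤ ε`, so the Lipschitz constant is `≤ 2ε`; `Δ :=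
  2ε·242/K⁹`; `|R(t) - R(s)| ≤ 2√R(s)·Δ + 3Δ² ≤ ε²(1936/K⁹ + 702768/K¹⁸) ≤ ε²/10⁶`.)
* §159 `clock_small_of_radius`: `b² + c² ≤ 4ε²`, `ε² ≤ 1/(6K²⁰)`, `K ≥ 16` ⇒ `b² ≤ 1/K¹⁰` — the
  local form of part 47's `late_clock_small` (`r ≤ 10`), for the same re-typing.

READING. With §158 the ring hypothesis of part 52 §154 (`hring`, via §153) is available at
EVERY pulse of the ladder from two local facts at its ignition time, with no reference to how
late the pulse occurs; what remains of (20′b) is the cold half of a rung (parts 39/47: the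
clock's zero, re-arming with entry clock `∈ [1.265ε, 1.44ε]` under `c ≤ ρ²/K⁹`, relight at `c
= ρ²/K⁹`) and the dousing law (parts 36/41/43: `T' - r ≤ 242/K⁹`, `b(T') ≤ -θ₂ε`, `c(T') ≤
λ₀ρ²`), whose caps `t ≤ 10`, `S ≤ 8`, `s ≤ 4.4` enter through `late_clock_small` (now §159)
and through the logarithmic pulse budget `second_budget` (`log(2ε(s + 1/16)K¹⁰/ρ²)`, which
for `s ≤ K⁸` changes `242/K⁹` by less than its slack).
HONEST LIMITS. (i) §157 is two-sided but §158 uses only `T - s ≤ 242/K⁹` and the entry radius: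
over a COLD stretch (length `≈ 2.85`) the Lipschitz bound `2.85(ε + σ)` exceeds the radius
itself and says nothing — the re-arming laws are genuinely needed there; (ii) the constant
`ε²/10⁶` is §135's (so that parts 45/52 apply verbatim); the true pulse change is `≲ 2·10³ε²/K⁹`;
(iii) nothing about Navier–Stokes.
[cite: Tao2016AveragedNS, §5.5 Theorem 5.3, (5.5), (5.6), (b-eq), (c-eq), proof (ob-2),
(energy-con)]
-/

noncomputable section

namespace Summit.NavierStokesRegularity.FluidComputer.GateBudget

open Real Set Filter Topology
open Literature.Analysis.FluidPDE.Tao2016AveragedNS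
open Literature.Analysis.FluidPDE.Tao2016AveragedNS.Thm53 (antitoneOn_sub_of_deriv_le)

section RadiusLipschitz

variable {ε σ μ R K : ℝ} {X : ℝ → Fin 5 → ℝ}

/-! ## §157 The clock-pair radius is `(ε + σ)`-Lipschitz -/

/-- **THE CLOCK-PAIR RADIUS IS LIPSCHITZ.** For any couplings with `ε, σ ≥ 0`, the trajectory of
`fiveGateCircuit ε σ μ R K` from (5.6) and `0 ≤ T`: for `t ∈ [T, T']`, `√(b(t)² + c(t)²) ≤
√(b(T)² + c(T)²) + (ε + σ)(t - T)` and `√(b(T)² + c(T)²) ≤ √(b(t)² + c(t)²) + (ε + σ)(t - T)`.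
(`∂ₜ(b² + c²) = 2a²(εb + σc)` by part 1's `bc_energy` — the amplifier `μ` cancels; with `g =
√(b² + c² + η²)`, `η > 0`: `g' = a²(εb + σc)/g` and `|εb + σc| ≤ ε|b| + σc ≤ (ε + σ)g` since `a²
≤ 1`, `c ≥ 0` (`c_nonneg`, `t ≥ 0`), `|b|, c ≤ g`; so `g ∓ (ε + σ)t` are antitone / `-g - (ε +
σ)t` antitone (toolkit `antitoneOn_sub_of_deriv_le`); `η → 0⁺` by `le_of_forall_pos_le_add`.)
[cite: Tao2016AveragedNS, §5.5 (5.5), (b-eq), (c-eq), proof (ob-2)] -/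
theorem radius_sqrt_lipschitz (hX : ∀ t, HasDerivAt X (fiveGateCircuit ε σ μ R K (X t)) t)
    (h0 : X 0 = delayInit) (hε : 0 ≤ ε) (hσ : 0 ≤ σ) {T T' : ℝ} (hT : 0 ≤ T) {t : ℝ}
    (ht : t ∈ Icc T T') :
    √(X t 1 ^ 2 + X t 2 ^ 2) ≤ √(X T 1 ^ 2 + X T 2 ^ 2) + (ε + σ) * (t - T) ∧
      √(X T 1 ^ 2 + X T 2 ^ 2) ≤ √(X t 1 ^ 2 + X t 2 ^ 2) + (ε + σ) * (t - T) := by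
  have hpos : ∀ η : ℝ, 0 < η → ∀ r, 0 < X r 1 ^ 2 + X r 2 ^ 2 + η ^ 2 := fun η hη r => by
    positivity
  -- the regularised radius and its derivative
  have hfd : ∀ η : ℝ, 0 < η → ∀ r, HasDerivAt (fun s => √(X s 1 ^ 2 + X s 2 ^ 2 + η ^ 2))
      ((2 * ε * X r 0 ^ 2 * X r 1 + 2 * σ * X r 0 ^ 2 * X r 2)
        / (2 * √(X r 1 ^ 2 + X r 2 ^ 2 + η ^ 2))) r :=
    fun η hη r => ((bc_energy (hX r)).add_const (η ^ 2)).sqrt (hpos η hη r).ne'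
  -- the pointwise bound `|2εa²b + 2σa²c| ≤ 2(ε + σ)g` for `r ≥ T ≥ 0`
  have hbd : ∀ η : ℝ, 0 < η → ∀ r, T ≤ r →
      |2 * ε * X r 0 ^ 2 * X r 1 + 2 * σ * X r 0 ^ 2 * X r 2|
        ≤ 2 * (ε + σ) * √(X r 1 ^ 2 + X r 2 ^ 2 + η ^ 2) := by
    intro η hη r hr
    set g := √(X r 1 ^ 2 + X r 2 ^ 2 + η ^ 2) with hg
    have hg0 : 0 < g := Real.sqrt_pos.2 (hpos η hη r)
    have ha : X r 0 ^ 2 ≤ 1 := traj_sq_le_one hX h0 r 0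
    have ha0 : 0 ≤ X r 0 ^ 2 := sq_nonneg _
    have hc0 : 0 ≤ X r 2 := c_nonneg hX h0 hσ (hT.trans hr)
    have hbg : |X r 1| ≤ g := by
      rw [hg, ← Real.sqrt_sq_eq_abs]
      exact Real.sqrt_le_sqrt (by nlinarith [sq_nonneg (X r 2), sq_nonneg η])
    have hcg : X r 2 ≤ g := by
      calc X r 2 = |X r 2| := (abs_of_nonneg hc0).symm
        _ ≤ g := by
          rw [hg, ← Real.sqrt_sq_eq_abs]
          exact Real.sqrt_le_sqrt (by nlinarith [sq_nonneg (X r 1), sq_nonneg η])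
    have h1 : |X r 0 ^ 2 * X r 1| ≤ g := by
      rw [abs_mul, abs_of_nonneg ha0]
      calc X r 0 ^ 2 * |X r 1| ≤ 1 * g := mul_le_mul ha hbg (abs_nonneg _) zero_le_one
        _ = g := one_mul g
    have h2 : 0 ≤ X r 0 ^ 2 * X r 2 := mul_nonneg ha0 hc0
    have h3 : X r 0 ^ 2 * X r 2 ≤ g := by
      calc X r 0 ^ 2 * X r 2 ≤ 1 * g := mul_le_mul ha hcg hc0 zero_le_one
        _ = g := one_mul g
    have h1' := (abs_le.1 h1)
    rw [abs_le]
    constructor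
    · nlinarith [h1'.1, h2, hε, hσ]
    · nlinarith [h1'.2, h3, hε, hσ]
  constructor
  · refine le_of_forall_pos_le_add fun η hη => ?_
    have hmono := antitoneOn_sub_of_deriv_le
      (f := fun s => √(X s 1 ^ 2 + X s 2 ^ 2 + η ^ 2))
      (f' := fun r => (2 * ε * X r 0 ^ 2 * X r 1 + 2 * σ * X r 0 ^ 2 * X r 2)
        / (2 * √(X r 1 ^ 2 + X r 2 ^ 2 + η ^ 2)))
      (φ := fun _ => (ε + σ) * 1) (Φ := fun r => (ε + σ) * (r - T)) (convex_Icc T T')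
      (fun r _ => hfd η hη r) (fun r _ => ((hasDerivAt_id' r).sub_const T).const_mul (ε + σ))
      (fun r hr => by
        show (2 * ε * X r 0 ^ 2 * X r 1 + 2 * σ * X r 0 ^ 2 * X r 2)
            / (2 * √(X r 1 ^ 2 + X r 2 ^ 2 + η ^ 2)) ≤ (ε + σ) * 1
        have hF : 0 < √(X r 1 ^ 2 + X r 2 ^ 2 + η ^ 2) := Real.sqrt_pos.2 (hpos η hη r)
        have h := (abs_le.1 (hbd η hη r hr.1)).2
        rw [div_le_iff₀ (by positivity)]
        nlinarith [h, hF])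
    have h := hmono (left_mem_Icc.2 (ht.1.trans ht.2)) ht ht.1
    dsimp only at h
    have hPT : 0 ≤ X T 1 ^ 2 + X T 2 ^ 2 := by positivity
    have hsT : 0 ≤ √(X T 1 ^ 2 + X T 2 ^ 2) := Real.sqrt_nonneg _
    have hηT : √(X T 1 ^ 2 + X T 2 ^ 2 + η ^ 2) ≤ √(X T 1 ^ 2 + X T 2 ^ 2) + η :=
      (Real.sqrt_le_left (by positivity)).2 (by nlinarith [Real.sq_sqrt hPT, hsT, hη.le])
    have hηt : √(X t 1 ^ 2 + X t 2 ^ 2) ≤ √(X t 1 ^ 2 + X t 2 ^ 2 + η ^ 2) :=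
      Real.sqrt_le_sqrt (by nlinarith [sq_nonneg η])
    have e1 : (ε + σ) * (T - T) = 0 := by ring
    linarith [h, hηT, hηt, e1]
  · refine le_of_forall_pos_le_add fun η hη => ?_
    have hmono := antitoneOn_sub_of_deriv_le
      (f := fun s => -√(X s 1 ^ 2 + X s 2 ^ 2 + η ^ 2))
      (f' := fun r => -((2 * ε * X r 0 ^ 2 * X r 1 + 2 * σ * X r 0 ^ 2 * X r 2)
        / (2 * √(X r 1 ^ 2 + X r 2 ^ 2 + η ^ 2))))
      (φ := fun _ => (ε + σ) * 1) (Φ := fun r => (ε + σ) * (r - T)) (convex_Icc T T')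
      (fun r _ => (hfd η hη r).neg)
      (fun r _ => ((hasDerivAt_id' r).sub_const T).const_mul (ε + σ))
      (fun r hr => by
        show -((2 * ε * X r 0 ^ 2 * X r 1 + 2 * σ * X r 0 ^ 2 * X r 2)
            / (2 * √(X r 1 ^ 2 + X r 2 ^ 2 + η ^ 2))) ≤ (ε + σ) * 1
        have hF : 0 < √(X r 1 ^ 2 + X r 2 ^ 2 + η ^ 2) := Real.sqrt_pos.2 (hpos η hη r)
        have h := (abs_le.1 (hbd η hη r hr.1)).1
        rw [← neg_div, div_le_iff₀ (by positivity)]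
        nlinarith [h, hF])
    have h := hmono (left_mem_Icc.2 (ht.1.trans ht.2)) ht ht.1
    dsimp only at h
    have hPt : 0 ≤ X t 1 ^ 2 + X t 2 ^ 2 := by positivity
    have hst : 0 ≤ √(X t 1 ^ 2 + X t 2 ^ 2) := Real.sqrt_nonneg _
    have hηt : √(X t 1 ^ 2 + X t 2 ^ 2 + η ^ 2) ≤ √(X t 1 ^ 2 + X t 2 ^ 2) + η :=
      (Real.sqrt_le_left (by positivity)).2 (by nlinarith [Real.sq_sqrt hPt, hst, hη.le])
    have hηT : √(X T 1 ^ 2 + X T 2 ^ 2) ≤ √(X T 1 ^ 2 + X T 2 ^ 2 + η ^ 2) :=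
      Real.sqrt_le_sqrt (by nlinarith [sq_nonneg η])
    have e1 : (ε + σ) * (T - T) = 0 := by ring
    linarith [h, hηT, hηt, e1]

end RadiusLipschitz

variable {K ε ρ : ℝ} {X : ℝ → Fin 5 → ℝ}

/-! ## §158 A pulse keeps the radius — horizon-free -/

set_option maxHeartbeats 400000 in
/-- **A PULSE KEEPS THE RADIUS, HORIZON-FREE.** Knob family `rotorCircuit K M ε ρ` (`M ≥ 0`, `0
< ε`, `ρ² ≤ ε`, `K ≥ 16`), the trajectory from (5.6); ANY `0 ≤ s ≤ T` with `T - s ≤ 242/K⁹` and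
entry radius `b(s)² + c(s)² ≤ 4ε²`: `|b(t)² + c(t)² - (b(s)² + c(s)²)| ≤ ε²/10⁶` for all `t ∈
[s, T]` — part 45 §135 with its cap `T ≤ 5` replaced by the local entry radius. (§157 with `σ =
ρ²e^{-M} ≤ ε`: `|√R(t) - √R(s)| ≤ Δ := 2ε(t - s) ≤ 484ε/K⁹`; `|R(t) - R(s)| ≤ 2√R(s)Δ + 3Δ² ≤
ε²(1936/K⁹ + 702768/K¹⁸) ≤ ε²/10⁶`, `K⁹ ≥ 2³⁶`.)
[cite: Tao2016AveragedNS, §5.5 Theorem 5.3, (5.5), (5.6), (b-eq), (c-eq), proof (ob-2)] -/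
theorem knob_radius_kept_free {M : ℝ}
    (hX : ∀ t, HasDerivAt X (RotorKnob.rotorCircuit K M ε ρ (X t)) t) (h0 : X 0 = delayInit)
    (hM : 0 ≤ M) (hε : 0 < ε) (hρε : ρ ^ 2 ≤ ε) (hK : 16 ≤ K) {s T : ℝ} (hs : 0 ≤ s)
    (hTs : T - s ≤ 242 / K ^ 9) (hRs : X s 1 ^ 2 + X s 2 ^ 2 ≤ 4 * ε ^ 2) :
    ∀ t ∈ Icc s T, |X t 1 ^ 2 + X t 2 ^ 2 - (X s 1 ^ 2 + X s 2 ^ 2)| ≤ ε ^ 2 / 10 ^ 6 := by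
  intro t ht
  have hK0 : 0 < K := by linarith
  have h9 : (68719476736 : ℝ) ≤ K ^ 9 := by
    have := headline_pow_floor hK 9; norm_num at this; exact this
  have hK9 : 0 < K ^ 9 := by positivity
  have hXf := hX
  rw [RotorKnob.rotorCircuit_eq_fiveGate] at hXf
  have hσ0 : 0 ≤ ρ ^ 2 * exp (-M) := by positivity
  have hσε : ρ ^ 2 * exp (-M) ≤ ε := by
    have h1 : exp (-M) ≤ 1 := by rw [Real.exp_le_one_iff]; linarith
    calc ρ ^ 2 * exp (-M) ≤ ε * 1 := mul_le_mul hρε h1 (Real.exp_pos _).le hε.le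
      _ = ε := mul_one ε
  obtain ⟨h1, h2⟩ := radius_sqrt_lipschitz hXf h0 hε.le hσ0 hs ht
  set u := √(X t 1 ^ 2 + X t 2 ^ 2) with hu
  set v := √(X s 1 ^ 2 + X s 2 ^ 2) with hv
  have hRt0 : 0 ≤ X t 1 ^ 2 + X t 2 ^ 2 := by positivity
  have hRs0 : 0 ≤ X s 1 ^ 2 + X s 2 ^ 2 := by positivity
  have hu2 : u ^ 2 = X t 1 ^ 2 + X t 2 ^ 2 := Real.sq_sqrt hRt0
  have hv2 : v ^ 2 = X s 1 ^ 2 + X s 2 ^ 2 := Real.sq_sqrt hRs0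
  have hu0 : 0 ≤ u := Real.sqrt_nonneg _
  have hv0 : 0 ≤ v := Real.sqrt_nonneg _
  have hvε : v ≤ 2 * ε := by
    rw [hv, show 2 * ε = √((2 * ε) ^ 2) from (Real.sqrt_sq (by positivity)).symm]
    exact Real.sqrt_le_sqrt (by nlinarith [hRs])
  -- the Lipschitz displacement `Δ ≤ 2ε(t - s) ≤ 484ε/K⁹`
  set Δ := (ε + ρ ^ 2 * exp (-M)) * (t - s) with hΔ
  have hτ0 : 0 ≤ t - s := by linarith [ht.1]
  have hτ : t - s ≤ 242 / K ^ 9 := by linarith [ht.2]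
  have hΔ0 : 0 ≤ Δ := by positivity
  have hΔb : Δ ≤ 2 * ε * (242 / K ^ 9) := by
    have : (ε + ρ ^ 2 * exp (-M)) * (t - s) ≤ (2 * ε) * (242 / K ^ 9) :=
      mul_le_mul (by linarith) hτ hτ0 (by positivity)
    linarith [this]
  -- `|u² - v²| ≤ 2vΔ + 3Δ²`
  have hdiff : |u ^ 2 - v ^ 2| ≤ 2 * v * Δ + 3 * Δ ^ 2 := by
    rw [abs_le]
    constructor
    · nlinarith [h1, h2, hu0, hv0, hΔ0]
    · nlinarith [h1, h2, hu0, hv0, hΔ0]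
  rw [← hu2, ← hv2]
  -- numerics: `2·2ε·484ε/K⁹ + 3(484ε/K⁹)² ≤ ε²/10⁶`
  have hx : 2 * v * Δ ≤ 2 * (2 * ε) * (2 * ε * (242 / K ^ 9)) := by
    have := mul_le_mul hvε hΔb hΔ0 (by positivity)
    linarith [this]
  have hy : Δ ^ 2 ≤ (2 * ε * (242 / K ^ 9)) ^ 2 := pow_le_pow_left₀ hΔ0 hΔb 2
  have hq : (242 : ℝ) / K ^ 9 ≤ 242 / 68719476736 :=
    div_le_div_of_nonneg_left (by norm_num) (by norm_num) h9
  have hq0 : (0 : ℝ) ≤ 242 / K ^ 9 := by positivity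
  have hε2 : 0 < ε ^ 2 := by positivity
  nlinarith [hdiff, hx, hy, hq, hq0, hε2, mul_le_mul hq hq hq0 (by norm_num)]

/-! ## §159 The clock is small wherever the radius is -/

/-- **The clock is small wherever the radius is.** `b² + c² ≤ 4ε²`, `ε² ≤ 1/(6K²⁰)`, `K ≥ 16` ⇒
`b² ≤ 1/K¹⁰` — the local form of part 47's `late_clock_small` (there from `r ≤ 10`).
[cite: Tao2016AveragedNS, §5.5 Theorem 5.3, (b-eq)] -/
theorem clock_small_of_radius {K ε b c : ℝ} (hK : 16 ≤ K) (hεK : ε ^ 2 ≤ 1 / (6 * K ^ 20))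
    (hR : b ^ 2 + c ^ 2 ≤ 4 * ε ^ 2) : b ^ 2 ≤ 1 / K ^ 10 := by
  have hK0 : 0 < K := by linarith
  have hK10 : 0 < K ^ 10 := by positivity
  have h10 : (1099511627776 : ℝ) ≤ K ^ 10 := by
    have := headline_pow_floor hK 10; norm_num at this; exact this
  have h1 : ε ^ 2 * K ^ 20 ≤ 1 / 6 := by
    rw [le_div_iff₀ (by positivity)] at hεK
    linarith [hεK]
  rw [le_div_iff₀ hK10]
  nlinarith [sq_nonneg c, hR, h1, h10, sq_nonneg (K ^ 10), mul_le_mul_of_nonneg_left h10 hK10.le]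

end Summit.NavierStokesRegularity.FluidComputer.GateBudget
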